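import Literature.AlgebraicGeometry.Motives.HodgeLieRankLowerBound
import HarnessLib

/-!
# Projector calculus for Hodge structures with two Hodge degrees `0, 1`: the off-diagonal blocks `P X_ℂ (1 − P)`,
# `(1 − P) X_ℂ P` of an element of `Lie Hg`, their conjugation symmetry, and membership in `(Lie Hg)_ℂ`

Family `hodge`, layer `Literature/AlgebraicGeometry/Motives`; THEOREMS ONLY (no definition, no named fact;
D-0026).  Linear-algebra preliminaries of `Motives/HodgeLieWeightOneRankThree` (cell `pub-hodgecm2`, lane
MT-RANK-FOUR), in the style of `Motives/MumfordTateLieAlgebraWeights`.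

SETTING.  `H` is a pure `ℚ`-Hodge structure of weight `n` on a finite-dimensional `V`, `e` a graded basis of `V_ℂ`
adapted to `H` with degrees `deg` (`exists_basis_F_eq_span`), ALL OF WHOSE DEGREES ARE `0` OR `1` (hypothesis `hdeg`;
for an effective `H` of weight `1`, e.g. `H¹` of an abelian variety, this is `IsEffective.deg_mem_Icc_of_graded`).
Then the grading operator `P = gradingEnd e deg` (`= p` on `V^{p,q}`) is the PROJECTOR onto `V¹ = span {e σ | deg σ = 1}
= V^{1,n-1}` along `V⁰ = span {e σ | deg σ = 0} = V^{0,n}`: `P² = P` (`gradingEnd_mul_gradingEnd_of_deg`).  For an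
operator `Y` on `V_ℂ` write `E_Y = P Y (1 − P)` (the block `V⁰ → V¹`, of `ad P`-weight `+1`) and `F_Y = (1 − P) Y P`
(the block `V¹ → V⁰`, weight `−1`).

* §1 `gradingEnd_mul_gradingEnd_of_deg`, `gradingEnd_apply_mem_span_one`, `one_sub_gradingEnd_apply_mem_span_zero`
  (ranges of `P`, `1 − P`), `exists_conjOp` (the conjugate `v ↦ conj (Y (conj v))` of a `ℂ`-linear operator is
  `ℂ`-linear).
* §2 (weight `n = 1`) `conj_gradingEnd_apply` — **`conj ∘ P = (1 − P) ∘ conj`** (`conj V^{1,0} = V^{0,1}`); hence for a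
  RATIONAL `X`, **`conj ∘ E_{X_ℂ} ∘ conj = F_{X_ℂ}`** (`conj_projE_conj_apply`): complex conjugation exchanges the two
  off-diagonal blocks of a rational operator (the weight-one case of `repr_baseChange_apply_eq_zero_of_neg`).
* §3 `mem_endAlg_of_projE_eq_zero` — if both off-diagonal blocks of `X_ℂ` vanish then `X` is a Hodge endomorphism
  (`[P, X_ℂ] = E − F = 0`, entries `repr_commutator_gradingEnd_apply_basis`, `mem_endAlg_of_repr_baseChange_eq_zero`);
  `projE_ne_zero_of_not_mem_endAlg` — so for `X ∉ End_Hdg(V)` rational BOTH blocks are non-zero (§2).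
* §4 `projE_mem_hodgeLieC` — **for `Y ∈ 𝔥_ℂ = (Lie Hg)_ℂ` both blocks `E_Y`, `F_Y` lie in `𝔥_ℂ`**:
  `2 E_Y = [P, Y] + [P, [P, Y]]`, `2 F_Y = [P, [P, Y]] − [P, Y]`, and `[P, ·]` preserves `𝔥_ℂ`
  (`commutator_gradingEnd_mem_hodgeLieC`: `Θ' = 2P − n ∈ 𝔥_ℂ`, Deligne I 3.4).

## References

* [Deligne1982HodgeCycles] P. Deligne, *Hodge cycles on abelian varieties*, LNM 900 (1982), I §3 (proof of Prop. 3.4: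
  `μ(𝔾ₘ) ⊆ MT_ℂ`, weights of `Ad μ`).
* [DeligneHodgeII1971] P. Deligne, *Théorie de Hodge II*, Publ. Math. IHÉS 40 (1971), 1.2.5, 2.1.4 (`conj V^{p,q} =
  V^{q,p}`, the real structure).
* [MoonenZarhin1999LowDim] B. Moonen, Yu. Zarhin, *Hodge classes on abelian varieties of low dimension*, Math. Ann. 315
  (1999), §2.
-/

noncomputable section

open scoped TensorProduct

namespace Literature.AlgebraicGeometry.Motives

universe u v

/-! ## §1 The grading operator of a `{0,1}`-graded basis is a projector -/

section Projector

variable {W : Type u} [AddCommGroup W] [Module ℂ W] {S : Type v} [Fintype S] [DecidableEq S] {deg : S → ℤ}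

/-- **`P² = P`** for the grading operator of a basis all of whose degrees are `0` or `1` (`P = deg σ ∈ {0,1}` on
`e σ`): on a Hodge structure with Hodge degrees `0, 1` Deligne's `μ(𝔾ₘ)` acts through the two characters `1, λ⁻¹` and
`Θ = dμ(1)` is the projector onto `V^{1,·}`. [cite: Deligne1982HodgeCycles, I §3 (3.1 and proof of Prop. 3.4)] -/
theorem gradingEnd_mul_gradingEnd_of_deg (e : Module.Basis S ℂ W) (hdeg : ∀ σ, deg σ = 0 ∨ deg σ = 1) :
    gradingEnd e deg * gradingEnd e deg = gradingEnd e deg := by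
  refine e.ext fun σ => ?_
  rw [Module.End.mul_apply, gradingEnd_apply_basis, map_smul, gradingEnd_apply_basis, smul_smul]
  rcases hdeg σ with h | h <;> simp [h]

omit [Fintype S] [DecidableEq S] in
/-- An operator whose values on a basis lie in a subspace takes all its values there. [folklore] -/
private theorem apply_mem_of_forall_basis (e : Module.Basis S ℂ W) (T : Module.End ℂ W) (N : Submodule ℂ W)
    (h : ∀ σ, T (e σ) ∈ N) (w : W) : T w ∈ N := by
  have htop : (⊤ : Submodule ℂ W) ≤ N.comap T := by
    rw [← e.span_eq, Submodule.span_le]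
    rintro _ ⟨σ, rfl⟩
    exact h σ
  exact htop Submodule.mem_top

/-- `P w ∈ V¹ = span {e σ | deg σ = 1}` (degrees in `{0,1}`): the range of `Θ = dμ(1)` is the piece of `μ`-weight
`1`. [cite: Deligne1982HodgeCycles, I §3 (3.1 and proof of Prop. 3.4)] -/
theorem gradingEnd_apply_mem_span_one (e : Module.Basis S ℂ W) (hdeg : ∀ σ, deg σ = 0 ∨ deg σ = 1) (w : W) :
    gradingEnd e deg w ∈ Submodule.span ℂ (e '' {σ | deg σ = 1}) := by
  refine apply_mem_of_forall_basis e _ _ (fun σ => ?_) w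
  rw [gradingEnd_apply_basis]
  rcases hdeg σ with h | h
  · rw [h]; simp
  · have hmem : e σ ∈ Submodule.span ℂ (e '' {σ | deg σ = 1}) := Submodule.subset_span ⟨σ, h, rfl⟩
    rw [h]; simpa using hmem

/-- `(1 − P) w ∈ V⁰ = span {e σ | deg σ = 0}` (degrees in `{0,1}`): the range of `1 − Θ` is the piece of
`μ`-weight `0`. [cite: Deligne1982HodgeCycles, I §3 (3.1 and proof of Prop. 3.4)] -/
theorem one_sub_gradingEnd_apply_mem_span_zero (e : Module.Basis S ℂ W) (hdeg : ∀ σ, deg σ = 0 ∨ deg σ = 1)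
    (w : W) : (1 - gradingEnd e deg) w ∈ Submodule.span ℂ (e '' {σ | deg σ = 0}) := by
  refine apply_mem_of_forall_basis e _ _ (fun σ => ?_) w
  rw [LinearMap.sub_apply, Module.End.one_apply, gradingEnd_apply_basis]
  rcases hdeg σ with h | h
  · have hmem : e σ ∈ Submodule.span ℂ (e '' {σ | deg σ = 0}) := Submodule.subset_span ⟨σ, h, rfl⟩
    rw [h]; simpa using hmem
  · rw [h]; simp

end Projector

namespace HodgeStructure

variable {V : Type u} [AddCommGroup V] [Module ℚ V] [Module.Finite ℚ V] [HodgeTensorFacts.{u, u}] {n : ℤ}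
  {S : Type u} [Fintype S] [DecidableEq S] {deg : S → ℤ}

omit [Module.Finite ℚ V] [HodgeTensorFacts.{u, u}] [Fintype S] [DecidableEq S] in
/-- **The conjugate of a `ℂ`-linear operator**: for every `ℂ`-linear `Y` on `V_ℂ` there is a `ℂ`-linear `Ȳ` with
`Ȳ v = conj (Y (conj v))` (`conj` is antilinear, so `conj ∘ Y ∘ conj` is linear; Deligne, Hodge II, 2.1.4: the real
structure of `V_ℂ`). [cite: DeligneHodgeII1971, 2.1.4] -/
theorem exists_conjOp (Y : Module.End ℂ (ℂ ⊗[ℚ] V)) :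
    ∃ Yb : Module.End ℂ (ℂ ⊗[ℚ] V), ∀ v, Yb v = conj (Y (conj v)) := by
  refine ⟨{ toFun := fun v => conj (Y (conj v)), map_add' := ?_, map_smul' := ?_ }, fun v => rfl⟩
  · intro x y
    simp only [map_add]
  · intro c x
    simp only [conj_smul, map_smul, RingHom.id_apply, starRingEnd_self_apply]

/-! ## §2 Weight one: conjugation exchanges `P` and `1 − P`, and the two off-diagonal blocks of a rational operator -/

omit [Module.Finite ℚ V] [HodgeTensorFacts.{u, u}] in
/-- **`conj (P v) = (1 − P) (conj v)`** in weight `n = 1`: `conj` maps `V^{1,0} = range P` onto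
`V^{0,1} = ker P` and vice versa (`conj V^{p,q} = V^{q,p}`).  Proof on the graded basis through the linear operator
`conj ∘ P ∘ conj` (`exists_conjOp`): `P` acts on `conj (e σ) ∈ V^{1 - deg σ, deg σ}` by `1 − deg σ`.
[cite: DeligneHodgeII1971, 1.2.5 and 2.1.4] -/
theorem conj_gradingEnd_apply (H : HodgeStructure V n) (hn : n = 1) (e : Module.Basis S ℂ (ℂ ⊗[ℚ] V))
    (hF : ∀ a, H.F a = Submodule.span ℂ (e '' {σ | a ≤ deg σ}))
    (hFc : ∀ a, complexConj (H.F a) = Submodule.span ℂ (e '' {σ | deg σ ≤ n - a}))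
    (v : ℂ ⊗[ℚ] V) :
    conj (gradingEnd e deg v) = conj v - gradingEnd e deg (conj v) := by
  subst hn
  obtain ⟨Pb, hPb⟩ := exists_conjOp (gradingEnd e deg)
  have hPdiag : ∀ σ, gradingEnd e deg (e σ) = (fun d : ℤ => (d : ℂ)) (deg σ) • e σ := gradingEnd_apply_basis e deg
  -- `conj ∘ P ∘ conj = 1 - P` on the basis
  have hPb' : Pb = 1 - gradingEnd e deg := by
    refine e.ext fun σ => ?_
    have hc : conj (e σ) ∈ H.piece (1 - deg σ) (1 - (1 - deg σ)) := by
      rw [sub_sub_cancel]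
      exact conj_mem_piece H (basis_mem_piece_of_graded H e hF hFc σ)
    have hPc : gradingEnd e deg (conj (e σ)) = (((1 - deg σ : ℤ)) : ℂ) • conj (e σ) :=
      apply_eq_smul_of_mem_piece_of_graded H e hF hFc _ (f := fun d : ℤ => (d : ℂ)) hPdiag (1 - deg σ) hc
    rw [hPb, hPc, conj_smul, conj_conj, map_intCast, LinearMap.sub_apply, Module.End.one_apply,
      gradingEnd_apply_basis, Int.cast_sub, Int.cast_one, sub_smul, one_smul]
  have h := hPb (conj v)
  rw [conj_conj, hPb', LinearMap.sub_apply, Module.End.one_apply] at h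
  -- `h : conj v - P (conj v) = conj (P v)`… rearranged
  rw [h]

omit [Module.Finite ℚ V] [HodgeTensorFacts.{u, u}] in
/-- `(1 − P) (conj v) = conj (P v)` and `P (conj v) = conj ((1 − P) v)` (weight `1`, degrees in `{0,1}`).
[cite: DeligneHodgeII1971, 2.1.4] -/
theorem gradingEnd_conj_apply (H : HodgeStructure V n) (hn : n = 1) (e : Module.Basis S ℂ (ℂ ⊗[ℚ] V))
    (hF : ∀ a, H.F a = Submodule.span ℂ (e '' {σ | a ≤ deg σ}))
    (hFc : ∀ a, complexConj (H.F a) = Submodule.span ℂ (e '' {σ | deg σ ≤ n - a}))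
    (v : ℂ ⊗[ℚ] V) :
    gradingEnd e deg (conj v) = conj ((1 - gradingEnd e deg) v) := by
  rw [LinearMap.sub_apply, Module.End.one_apply, map_sub, conj_gradingEnd_apply H hn e hF hFc v, sub_sub_cancel]

omit [Module.Finite ℚ V] [HodgeTensorFacts.{u, u}] in
/-- **Conjugation exchanges the two off-diagonal blocks of a RATIONAL operator**: for `X ∈ End_ℚ V`,
`conj ((P X_ℂ (1 − P)) (conj v)) = ((1 − P) X_ℂ P) v` (weight `1`, degrees in `{0,1}`; `X_ℂ` commutes with `conj`,
`conj_baseChange`, and `conj ∘ P = (1 − P) ∘ conj`). [cite: DeligneHodgeII1971, 2.1.4] [cite: Deligne1982HodgeCycles, I §3 (proof of Prop. 3.4)] -/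
theorem conj_projE_conj_apply (H : HodgeStructure V n) (hn : n = 1) (e : Module.Basis S ℂ (ℂ ⊗[ℚ] V))
    (hF : ∀ a, H.F a = Submodule.span ℂ (e '' {σ | a ≤ deg σ}))
    (hFc : ∀ a, complexConj (H.F a) = Submodule.span ℂ (e '' {σ | deg σ ≤ n - a}))
    (X : Module.End ℚ V) (v : ℂ ⊗[ℚ] V) :
    conj ((gradingEnd e deg * X.baseChange ℂ * (1 - gradingEnd e deg)) (conj v)) =
      ((1 - gradingEnd e deg) * X.baseChange ℂ * gradingEnd e deg) v := by
  have h1 : (1 - gradingEnd e deg) (conj v) = conj (gradingEnd e deg v) := by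
    rw [LinearMap.sub_apply, Module.End.one_apply, conj_gradingEnd_apply H hn e hF hFc v]
  rw [Module.End.mul_apply, Module.End.mul_apply, h1, ← conj_baseChange,
    conj_gradingEnd_apply H hn e hF hFc, conj_conj, Module.End.mul_apply,
    Module.End.mul_apply, LinearMap.sub_apply, Module.End.one_apply]

omit [Module.Finite ℚ V] [HodgeTensorFacts.{u, u}] in
/-- Symmetric form: `conj (((1 − P) X_ℂ P) (conj v)) = (P X_ℂ (1 − P)) v` for rational `X`.
[cite: DeligneHodgeII1971, 2.1.4] -/
theorem conj_projF_conj_apply (H : HodgeStructure V n) (hn : n = 1) (e : Module.Basis S ℂ (ℂ ⊗[ℚ] V))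
    (hF : ∀ a, H.F a = Submodule.span ℂ (e '' {σ | a ≤ deg σ}))
    (hFc : ∀ a, complexConj (H.F a) = Submodule.span ℂ (e '' {σ | deg σ ≤ n - a}))
    (X : Module.End ℚ V) (v : ℂ ⊗[ℚ] V) :
    conj (((1 - gradingEnd e deg) * X.baseChange ℂ * gradingEnd e deg) (conj v)) =
      (gradingEnd e deg * X.baseChange ℂ * (1 - gradingEnd e deg)) v := by
  have h := conj_projE_conj_apply H hn e hF hFc X (conj v)
  rw [conj_conj] at h
  rw [← h, conj_conj]

/-! ## §3 An operator with both off-diagonal blocks zero is a Hodge endomorphism -/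

omit [Module.Finite ℚ V] [HodgeTensorFacts.{u, u}] in
/-- **If `P X_ℂ (1 − P) = 0` and `(1 − P) X_ℂ P = 0` then `X ∈ End_Hdg(V)`** (degrees in `{0,1}`): then
`[P, X_ℂ] = P X_ℂ (1 − P) − (1 − P) X_ℂ P = 0`, so every entry of `X_ℂ` of non-zero weight vanishes
(`repr_commutator_gradingEnd_apply_basis`) and `X` preserves the Hodge filtration (`mem_endAlg_of_repr_baseChange_eq_zero`).
[cite: Deligne1982HodgeCycles, I §3 (proof of Prop. 3.4)] -/
theorem mem_endAlg_of_projE_eq_zero (H : HodgeStructure V n) (e : Module.Basis S ℂ (ℂ ⊗[ℚ] V))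
    (hF : ∀ a, H.F a = Submodule.span ℂ (e '' {σ | a ≤ deg σ})) (hdeg : ∀ σ, deg σ = 0 ∨ deg σ = 1)
    {X : Module.End ℚ V} (hE : gradingEnd e deg * X.baseChange ℂ * (1 - gradingEnd e deg) = 0)
    (hF0 : (1 - gradingEnd e deg) * X.baseChange ℂ * gradingEnd e deg = 0) : X ∈ H.endAlg := by
  set P := gradingEnd e deg with hP
  set Y := X.baseChange ℂ with hY
  have hPP : P * P = P := gradingEnd_mul_gradingEnd_of_deg e hdeg
  have hcomm : P * Y - Y * P = 0 := by
    have h : P * Y - Y * P = P * Y * (1 - P) - (1 - P) * Y * P := by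
      simp only [mul_sub, sub_mul, mul_one, one_mul]
      have h1 : P * Y * P = P * Y * P := rfl
      abel
    rw [h, hE, hF0, sub_zero]
  refine mem_endAlg_of_repr_baseChange_eq_zero H e hF fun σ τ hστ => ?_
  have h := repr_commutator_gradingEnd_apply_basis e deg Y σ τ
  rw [← hP, hcomm, LinearMap.zero_apply, map_zero, Finsupp.coe_zero, Pi.zero_apply] at h
  have hm : ((deg σ : ℂ) - deg τ) ≠ 0 := sub_ne_zero.2 fun h' => hστ (Int.cast_injective h')
  exact (mul_eq_zero.1 h.symm).resolve_left hm

omit [Module.Finite ℚ V] [HodgeTensorFacts.{u, u}] in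
/-- **For a rational `X ∉ End_Hdg(V)` both off-diagonal blocks of `X_ℂ` are non-zero** (weight `1`, degrees in
`{0,1}`): they cannot both vanish (`mem_endAlg_of_projE_eq_zero`), and each is the conjugate of the other
(`conj_projE_conj_apply`). [cite: Deligne1982HodgeCycles, I §3 (proof of Prop. 3.4)] [cite: DeligneHodgeII1971, 2.1.4] -/
theorem projE_ne_zero_of_not_mem_endAlg (H : HodgeStructure V n) (hn : n = 1) (e : Module.Basis S ℂ (ℂ ⊗[ℚ] V))
    (hF : ∀ a, H.F a = Submodule.span ℂ (e '' {σ | a ≤ deg σ}))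
    (hFc : ∀ a, complexConj (H.F a) = Submodule.span ℂ (e '' {σ | deg σ ≤ n - a}))
    (hdeg : ∀ σ, deg σ = 0 ∨ deg σ = 1) {X : Module.End ℚ V} (hXE : X ∉ H.endAlg) :
    gradingEnd e deg * X.baseChange ℂ * (1 - gradingEnd e deg) ≠ 0 ∧
      (1 - gradingEnd e deg) * X.baseChange ℂ * gradingEnd e deg ≠ 0 := by
  have hEF : gradingEnd e deg * X.baseChange ℂ * (1 - gradingEnd e deg) = 0 →
      (1 - gradingEnd e deg) * X.baseChange ℂ * gradingEnd e deg = 0 := by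
    intro hE
    refine LinearMap.ext fun v => ?_
    rw [← conj_projE_conj_apply H hn e hF hFc X v, hE, LinearMap.zero_apply, map_zero, LinearMap.zero_apply]
  have hFE : (1 - gradingEnd e deg) * X.baseChange ℂ * gradingEnd e deg = 0 →
      gradingEnd e deg * X.baseChange ℂ * (1 - gradingEnd e deg) = 0 := by
    intro hF0
    refine LinearMap.ext fun v => ?_
    rw [← conj_projF_conj_apply H hn e hF hFc X v, hF0, LinearMap.zero_apply, map_zero, LinearMap.zero_apply]
  constructor
  · intro hE
    exact hXE (mem_endAlg_of_projE_eq_zero H e hF hdeg hE (hEF hE))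
  · intro hF0
    exact hXE (mem_endAlg_of_projE_eq_zero H e hF hdeg (hFE hF0) hF0)

/-! ## §4 The off-diagonal blocks of an element of `(Lie Hg)_ℂ` lie in `(Lie Hg)_ℂ` -/

/-- **For `Y ∈ 𝔥_ℂ` the blocks `P Y (1 − P)` and `(1 − P) Y P` lie in `𝔥_ℂ`** (degrees in `{0,1}`):
`2 · P Y (1 − P) = [P, Y] + [P, [P, Y]]` and `2 · (1 − P) Y P = [P, [P, Y]] − [P, Y]` (`P² = P`), and `ad P` preserves
`𝔥_ℂ` (`commutator_gradingEnd_mem_hodgeLieC`).  These are the root components of `Y` of weights `±1` for `ad Θ`.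
[cite: Deligne1982HodgeCycles, I §3 (proof of Prop. 3.4)] [cite: MoonenZarhin1999LowDim, §2] -/
theorem projE_mem_hodgeLieC (H : HodgeStructure V n) (e : Module.Basis S ℂ (ℂ ⊗[ℚ] V))
    (hF : ∀ a, H.F a = Submodule.span ℂ (e '' {σ | a ≤ deg σ}))
    (hFc : ∀ a, complexConj (H.F a) = Submodule.span ℂ (e '' {σ | deg σ ≤ n - a}))
    (hdeg : ∀ σ, deg σ = 0 ∨ deg σ = 1) {Y : Module.End ℂ (ℂ ⊗[ℚ] V)} (hY : Y ∈ H.hodgeLieC) :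
    gradingEnd e deg * Y * (1 - gradingEnd e deg) ∈ H.hodgeLieC ∧
      (1 - gradingEnd e deg) * Y * gradingEnd e deg ∈ H.hodgeLieC := by
  set P := gradingEnd e deg with hP
  have hPP : P * P = P := gradingEnd_mul_gradingEnd_of_deg e hdeg
  have hPP' : ∀ Z : Module.End ℂ (ℂ ⊗[ℚ] V), Z * P * P = Z * P := fun Z => by rw [mul_assoc, hPP]
  have h1 : P * Y - Y * P ∈ H.hodgeLieC := commutator_gradingEnd_mem_hodgeLieC H e hF hFc hY
  have h2 : P * (P * Y - Y * P) - (P * Y - Y * P) * P ∈ H.hodgeLieC :=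
    commutator_gradingEnd_mem_hodgeLieC H e hF hFc h1
  have hE : P * Y * (1 - P) = (2 : ℂ)⁻¹ • ((P * Y - Y * P) + (P * (P * Y - Y * P) - (P * Y - Y * P) * P)) := by
    have h : (P * Y - Y * P) + (P * (P * Y - Y * P) - (P * Y - Y * P) * P) = (2 : ℂ) • (P * Y * (1 - P)) := by
      simp only [mul_sub, sub_mul, mul_one, ← mul_assoc, hPP, hPP', two_smul]
      abel
    rw [h, smul_smul, inv_mul_cancel₀ (two_ne_zero : (2 : ℂ) ≠ 0), one_smul]
  have hF' : (1 - P) * Y * P = (2 : ℂ)⁻¹ • ((P * (P * Y - Y * P) - (P * Y - Y * P) * P) - (P * Y - Y * P)) := by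
    have h : (P * (P * Y - Y * P) - (P * Y - Y * P) * P) - (P * Y - Y * P) = (2 : ℂ) • ((1 - P) * Y * P) := by
      simp only [mul_sub, sub_mul, one_mul, ← mul_assoc, hPP, hPP', two_smul]
      abel
    rw [h, smul_smul, inv_mul_cancel₀ (two_ne_zero : (2 : ℂ) ≠ 0), one_smul]
  constructor
  · rw [hE]
    exact H.hodgeLieC.smul_mem _ (H.hodgeLieC.add_mem h1 h2)
  · rw [hF']
    exact H.hodgeLieC.smul_mem _ (H.hodgeLieC.sub_mem h2 h1)

end HodgeStructure

end Literature.AlgebraicGeometry.Motives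

end
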